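import Literature.NumberTheory.Sieve.LiouvillePolynomialValues
import Literature.NumberTheory.Sieve.LiouvillePolynomialValuesProofs
import HarnessLib

/-!
# `λ(n² + 1)` is not eventually periodic; Teräväinen 2024, Theorem 2.3 (PROVED)

Fourth sibling proof file (theorems only, no named facts, no `sorry`) of
`Literature/NumberTheory/Sieve/LiouvillePolynomialValues.lean`; it DISCHARGES the named fact
`Literature.NumberTheory.Sieve.teravainen2024_thm_2_3` — J. Teräväinen, *On the Liouville function
at polynomial arguments*, Amer. J. Math. 146 (2024) 1115–1167 = arXiv:2010.07924, **Theorem 2.3**: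
for `k ≥ 1` and distinct integers `h₁, …, h_k`, `λ(∏ᵢ ((n+hᵢ)² + 1)) = v` for infinitely many `n`,
for either `v ∈ {−1, +1}` — as `teravainen2024_thm_2_3_holds`. The other siblings
(`…Proofs.lean`, `…Density.lean`, `…SmoothProofs.lean`, `…ReducibleProofs.lean`) treat Cor. 2.1 and
Prop. 2.11 and are not used here beyond the `liouvilleInt` API of `…Proofs.lean`.

## The printed proof (source §7, pp. 18–22 of the arXiv version) and what is formalised

* **Step 1 = Lemma 7.1** (`teravainen2024_thm_2_3_holds`): if one sign occurs only finitely often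
  then `∏ᵢ λ((n+hᵢ)²+1)` is eventually constant, so `f(n) := λ(n²+1)` satisfies a `±1`-valued
  recurrence of order `K = max hᵢ − min hᵢ`; two equal windows of length `K` (pigeonhole,
  `Finite.exists_ne_map_eq_of_infinite`) then propagate forever, so `f` is eventually periodic.
* **Steps 2–4** (`liouvilleInt_sq_add_one_not_eventually_periodic`): `f` is NOT eventually
  periodic. The source derives from the identity
  `(x²+1)(y²+1)(z²+1) = (xyz−x−y−z)² + (xy+yz+zx−1)²` (`liouvilleInt_three`) and its
  **Lemma 7.3** (integer lifts of residues `(a₁,a₂,a₃) mod q` with `S = xy+yz+zx−1 ∣ xyz−x−y−z`,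
  found with Dirichlet primes; here `exists_lift_dvd`, case `a₃ = 0`, using Mathlib's
  `Nat.forall_exists_prime_gt_and_zmodEq`) a functional equation for the periodic pattern, then
  CLASSIFIES its solutions as twisted real characters (Prop. 7.4, Lemmas 7.7–7.11, 2½ pages) and
  kills those with Legendre's theorem on `x² − py² = −1` and Dirichlet's theorem (Lemma 7.12).
  We follow the same route but replace the classification by the two consequences of the
  functional equation that the endgame actually needs:
  (zero) `f ≡ 1` on the class `0 mod q` (two-variable identity `liouvilleInt_two` at `x ≡ 1`);
  (even) `f` agrees on the classes `2b` and `−2b` (Lemma 7.3 with `(b,0,0)` and `x₁ < 0`);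
  (tt0) `f(2t)·f(−2t)·f(0·) = f(2w)` with `w ≡ −2t/(4t²−1)` (Lemma 7.3 with `(t,t,0)`).
  Endgame as in Lemma 7.12: a prime `p ≡ 1 (mod 8q)` (Dirichlet), `N² + 1 = p y²` (Legendre,
  `exists_neg_pell_of_prime_mod_four_eq_one`, proved here from Mathlib's fundamental solution
  `Pell.IsFundamental`), so `f(N) = λ(p)λ(y)² = −1`; an explicit root `a = 2t` of
  `N a² + 2a ≡ N (mod 2q)` with `a² − 1` a unit (`exists_root_quadratic_congr`: `a ≡ (N/2)·u⁻¹`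
  modulo each prime power, `u = (1 ± y)/2`, glued by CRT) makes `2w ≡ N (mod q)`, whence
  `f(N) = f(2t) f(−2t) · 1 = +1`, a contradiction.
* Deviations from print, all inessential: Lemma 7.3 is proved with ONE Dirichlet prime `r`
  (the auxiliary `p` of the source is replaced by an integer `p' ≡ (a₁+a₂)/d (mod q)` and
  `r ≡ 1 (mod 4p')`, `x₁ ≡ 0 (mod p')`, which avoids the quadratic-residue condition
  `x₁² ≡ (r−1)/4 (mod dp)` of the printed construction); the sign of `x₁` is tracked because
  `f` is only known to be periodic for `n ≥ C` (the source tacitly uses `η(|x|)`); no appeal to the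
  theory of Pell equations beyond Legendre's theorem is needed (the source's `16n²+1 = 17y², 65y²`
  step is subsumed by (zero)).

## References

* J. Teräväinen, *On the Liouville function at polynomial arguments*, Amer. J. Math. 146 (2024),
  no. 4, 1115–1167; arXiv:2010.07924, §7 (Lemma 7.1, Lemma 7.3, Proposition 7.4, Lemma 7.12).
  [Teravainen2024]
* A.-M. Legendre, *Essai sur la théorie des nombres* (1798), for `x² − py² = −1`, `p ≡ 1 (mod 4)`
  (folklore; proved here from the fundamental solution of the positive Pell equation).
-/

namespace Literature.NumberTheory.Sieve

open ArithmeticFunction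

/-! ### `liouvilleInt` API and the multiplicativity identities (Teräväinen 2024, §7.2) -/

/-- `λ(p) = −1` for a prime `p`. [folklore] -/
theorem liouvilleInt_prime {p : ℕ} (hp : p.Prime) : liouvilleInt p = -1 := by
  simp [liouvilleInt, liouville_apply hp.ne_zero, cardFactors_apply_prime hp]

/-- `n² + 1 ≠ 0` in `ℤ`. [folklore] -/
theorem int_sq_add_one_ne_zero (n : ℤ) : n ^ 2 + 1 ≠ 0 := by positivity

/-- `λ(n²+1) ∈ {1, −1}`. [folklore] -/
theorem liouvilleInt_sq_add_one_eq_one_or (n : ℤ) :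
    liouvilleInt (n ^ 2 + 1) = 1 ∨ liouvilleInt (n ^ 2 + 1) = -1 :=
  liouvilleInt_eq_one_or_eq_neg_one (int_sq_add_one_ne_zero n)

/-- `λ(n²+1) ≠ 0`. [folklore] -/
theorem liouvilleInt_sq_add_one_ne_zero (n : ℤ) : liouvilleInt (n ^ 2 + 1) ≠ 0 := by
  rcases liouvilleInt_sq_add_one_eq_one_or n with h | h <;> simp [h]

/-- The three-variable multiplicativity identity of §7.2 of the source: if
`S = xy + yz + zx − 1 ≠ 0` divides `T = xyz − x − y − z`, `T = S·W`, then
`(x²+1)(y²+1)(z²+1) = T² + S² = S²(W²+1)` and hence `λ(x²+1)λ(y²+1)λ(z²+1) = λ(W²+1)`.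
[cite: Teravainen2024, §7.2 (the displayed identity preceding Lemma 7.3)] -/
theorem liouvilleInt_three {x y z W : ℤ} (hS : x * y + y * z + z * x - 1 ≠ 0)
    (hW : (x * y + y * z + z * x - 1) * W = x * y * z - x - y - z) :
    liouvilleInt (x ^ 2 + 1) * liouvilleInt (y ^ 2 + 1) * liouvilleInt (z ^ 2 + 1) =
      liouvilleInt (W ^ 2 + 1) := by
  have key : (x ^ 2 + 1) * (y ^ 2 + 1) * (z ^ 2 + 1) =
      ((x * y + y * z + z * x - 1) * (x * y + y * z + z * x - 1)) * (W ^ 2 + 1) := by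
    linear_combination (-(x * y * z - x - y - z + (x * y + y * z + z * x - 1) * W)) * hW
  rw [← liouvilleInt_mul, ← liouvilleInt_mul, key, liouvilleInt_mul, liouvilleInt_mul,
    liouvilleInt_mul_self hS, one_mul]

/-- The two-variable identity `(x²+1)((x−1)²+1) = (x²−x+1)² + 1` (a case of the
Brahmagupta–Fibonacci identity), whence `λ(x²+1)λ((x−1)²+1) = λ((x²−x+1)²+1)`. [folklore] -/
theorem liouvilleInt_two (x : ℤ) :
    liouvilleInt (x ^ 2 + 1) * liouvilleInt ((x - 1) ^ 2 + 1) =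
      liouvilleInt ((x ^ 2 - x + 1) ^ 2 + 1) := by
  rw [← liouvilleInt_mul]; congr 1; ring

/-! ### Elementary arithmetic helpers -/

/-- The `q`-smooth part of a nonzero integer: `s = d·e` with `d > 0` dividing a power of `q` and
`e` coprime to `q`. [folklore] -/
theorem exists_smooth_part (q : ℕ) (s : ℤ) (hs : s ≠ 0) :
    ∃ (d e : ℤ) (n : ℕ), 0 < d ∧ s = d * e ∧ d ∣ (q : ℤ) ^ n ∧ IsCoprime e q := by
  suffices H : ∀ m : ℕ, ∀ s : ℤ, s.natAbs = m → s ≠ 0 →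
      ∃ (d e : ℤ) (n : ℕ), 0 < d ∧ s = d * e ∧ d ∣ (q : ℤ) ^ n ∧ IsCoprime e q from
    H _ s rfl hs
  intro m
  induction m using Nat.strong_induction_on with
  | _ m ih =>
    intro s hsm hs0
    by_cases hc : IsCoprime s q
    · exact ⟨1, s, 0, one_pos, by ring, by simp, hc⟩
    · have hg1 : Int.gcd s q ≠ 1 := by rwa [Int.isCoprime_iff_gcd_eq_one] at hc
      have hg0 : Int.gcd s q ≠ 0 := by
        rw [Ne, Int.gcd_eq_zero_iff]; omega
      obtain ⟨s', hs'⟩ : (Int.gcd s q : ℤ) ∣ s := Int.gcd_dvd_left (a := s) (b := q)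
      have hs'0 : s' ≠ 0 := by rintro rfl; simp at hs'; exact hs0 hs'
      have hlt : s'.natAbs < m := by
        have h1 : s.natAbs = Int.gcd s q * s'.natAbs := by
          conv_lhs => rw [hs']
          rw [Int.natAbs_mul, Int.natAbs_natCast]
        have h2 : 0 < s'.natAbs := Int.natAbs_pos.mpr hs'0
        have h3 : 2 ≤ Int.gcd s q := by omega
        rw [← hsm, h1]; nlinarith
      obtain ⟨d, e, n, hd, hse, hdq, hcop⟩ := ih _ hlt s' rfl hs'0
      refine ⟨Int.gcd s q * d, e, n + 1, by positivity, ?_, ?_, hcop⟩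
      · calc s = (Int.gcd s q : ℤ) * s' := hs'
          _ = _ := by rw [hse]; ring
      · rw [pow_succ']
        exact mul_dvd_mul (Int.gcd_dvd_right (a := s) (b := q)) hdq

/-- Every residue class modulo `L > 0` has arbitrarily large representatives. [folklore] -/
theorem exists_modEq_ge (L : ℤ) (hL : 0 < L) (x₀ X : ℤ) : ∃ x : ℤ, x ≡ x₀ [ZMOD L] ∧ X ≤ x := by
  refine ⟨x₀ + L * (X - x₀).natAbs, ?_, ?_⟩
  · exact Int.modEq_iff_dvd.mpr ⟨-((X - x₀).natAbs : ℤ), by ring⟩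
  · have h1 : X - x₀ ≤ ((X - x₀).natAbs : ℤ) := Int.le_natAbs
    nlinarith



/-- **Legendre's theorem** on the negative Pell equation: for a prime `p ≡ 1 (mod 4)` the
equation `x² − p y² = −1` has a solution in positive integers. Proof: the fundamental solution
`(x₁, y₁)` of `x² − p y² = 1` has `x₁` odd, and `(x₁−1)/2 · (x₁+1)/2 = p (y₁/2)²` with coprime
factors forces `(x₁+1)/2 = p t²`, `(x₁−1)/2 = s²` (the other case gives a smaller solution of the
positive equation), whence `s² − p t² = −1`. [folklore] -/
theorem exists_neg_pell_of_prime_mod_four_eq_one {p : ℕ} (hp : p.Prime) (hp4 : p % 4 = 1) :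
    ∃ x y : ℤ, 0 < x ∧ 0 < y ∧ x ^ 2 - p * y ^ 2 = -1 := by
  have hpZ : Prime (p : ℤ) := Nat.prime_iff_prime_int.mp hp
  have hd0 : (0 : ℤ) < p := by exact_mod_cast hp.pos
  obtain ⟨a, ha⟩ := Pell.IsFundamental.exists_of_not_isSquare hd0 hpZ.not_isSquare
  have hx1 : 1 < a.x := ha.1
  have hprop : a.x ^ 2 - p * a.y ^ 2 = 1 := a.prop
  have hp1 : (p : ZMod 4) = 1 := by
    rw [← ZMod.natCast_mod, hp4]; simp
  -- `x₁` is odd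
  have hxodd : a.x % 2 = 1 := by
    by_contra hxe
    obtain ⟨u, hu⟩ : ∃ u, a.x = 2 * u := ⟨a.x / 2, by omega⟩
    have key : (2 * (u : ZMod 4)) ^ 2 - (a.y : ZMod 4) ^ 2 = 1 := by
      have := congrArg (Int.cast : ℤ → ZMod 4) hprop
      push_cast [hu] at this
      rwa [hp1, one_mul] at this
    have hall : ∀ c b : ZMod 4, (2 * c) ^ 2 - b ^ 2 ≠ 1 := by decide
    exact hall _ _ key
  obtain ⟨w, hw⟩ : ∃ w, a.x = 2 * w + 1 := ⟨a.x / 2, by omega⟩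
  have hw1 : 1 ≤ w := by omega
  have h4 : (p : ℤ) * a.y ^ 2 = 4 * (w * (w + 1)) := by
    have := hprop; rw [hw] at this; linear_combination -this
  -- `y₁` is even
  have h2y : (2 : ℤ) ∣ a.y := by
    have h2 : (2 : ℤ) ∣ (p : ℤ) * a.y ^ 2 := ⟨2 * (w * (w + 1)), by rw [h4]; ring⟩
    rcases Int.prime_two.dvd_or_dvd h2 with h | h
    · exfalso
      have : (p : ℤ) % 2 = 1 := by exact_mod_cast (show p % 2 = 1 by omega)
      omega
    · exact Int.prime_two.dvd_of_dvd_pow h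
  obtain ⟨z, hz⟩ := h2y
  have h5 : w * (w + 1) = p * z ^ 2 := by
    apply mul_left_cancel₀ (by norm_num : (4 : ℤ) ≠ 0)
    rw [hz] at h4; linear_combination -h4
  have hcop : IsCoprime w (w + 1) := ⟨-1, 1, by ring⟩
  have hdvd : (p : ℤ) ∣ w * (w + 1) := ⟨z ^ 2, h5⟩
  rcases hpZ.dvd_or_dvd hdvd with ⟨w', hw'⟩ | ⟨w', hw'⟩
  · -- `p ∣ w`: leads to a smaller positive solution, contradiction
    exfalso
    have h6 : w' * (w + 1) = z ^ 2 := by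
      apply mul_left_cancel₀ hd0.ne'
      rw [← mul_assoc, ← hw', h5]
    have hcop' : IsCoprime w' (w + 1) :=
      IsCoprime.of_mul_left_right (show IsCoprime ((p : ℤ) * w') (w + 1) by rw [← hw']; exact hcop)
    obtain ⟨t, ht⟩ := Int.sq_of_isCoprime hcop'.symm (by rw [mul_comm]; exact h6)
    have ht' : w + 1 = t ^ 2 := by
      rcases ht with ht | ht
      · exact ht
      · nlinarith [sq_nonneg t]
    have hw'pos : 0 < w' := by
      by_contra hle
      have : (p : ℤ) * w' ≤ 0 := mul_nonpos_of_nonneg_of_nonpos hd0.le (not_lt.mp hle)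
      linarith
    obtain ⟨s, hs⟩ := Int.sq_of_isCoprime hcop' h6
    have hs' : w' = s ^ 2 := by
      rcases hs with hs | hs
      · exact hs
      · nlinarith [sq_nonneg s]
    have hsol : (|t|) ^ 2 - p * s ^ 2 = 1 := by
      rw [sq_abs, ← ht', ← hs']; linarith [hw']
    have hbx : 1 < (Pell.Solution₁.mk |t| s hsol).x := by
      simp only [Pell.Solution₁.x_mk]
      nlinarith [sq_abs t, abs_nonneg t]
    have hle := ha.2.2 hbx
    simp only [Pell.Solution₁.x_mk] at hle
    nlinarith [sq_abs t, abs_nonneg t]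
  · -- `p ∣ w + 1`: gives the negative Pell solution
    have h6 : w * w' = z ^ 2 := by
      apply mul_left_cancel₀ hd0.ne'
      calc (p : ℤ) * (w * w') = w * (p * w') := by ring
        _ = w * (w + 1) := by rw [hw']
        _ = p * z ^ 2 := h5
    have hcop' : IsCoprime w w' :=
      IsCoprime.of_mul_right_right (show IsCoprime w ((p : ℤ) * w') by rw [← hw']; exact hcop)
    obtain ⟨s, hs⟩ := Int.sq_of_isCoprime hcop' h6
    have hs' : w = s ^ 2 := by
      rcases hs with hs | hs
      · exact hs
      · nlinarith [sq_nonneg s]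
    obtain ⟨t, ht⟩ := Int.sq_of_isCoprime hcop'.symm (by rw [mul_comm]; exact h6)
    have hw'pos : 0 < w' := by
      by_contra hle
      have : (p : ℤ) * w' ≤ 0 := mul_nonpos_of_nonneg_of_nonpos hd0.le (not_lt.mp hle)
      linarith
    have ht' : w' = t ^ 2 := by
      rcases ht with ht | ht
      · exact ht
      · nlinarith [sq_nonneg t]
    refine ⟨|s|, |t|, ?_, ?_, ?_⟩
    · have : s ≠ 0 := by rintro rfl; simp at hs'; omega
      exact abs_pos.mpr this
    · have : t ≠ 0 := by rintro rfl; simp at ht'; omega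
      exact abs_pos.mpr this
    · rw [sq_abs, sq_abs, ← hs', ← ht']
      linarith [hw']


/-! ### Lemma 7.3 of the source (lifting residues to an exact divisibility), case `a₃ = 0` -/

/-- If `a ≡ b (mod n)` and `n ∣ b` then `n ∣ a`. [folklore] -/
theorem dvd_of_modEq_of_dvd {n a b : ℤ} (h : a ≡ b [ZMOD n]) (hb : n ∣ b) : n ∣ a :=
  h.dvd_iff.mpr hb

/-- A prime (natural number) `r` exceeding a positive integer `K` is coprime to it. [folklore] -/
theorem isCoprime_of_prime_of_lt {r : ℕ} (hr : r.Prime) {K : ℤ} (hK0 : 0 < K) (hKr : K < r) :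
    IsCoprime K (r : ℤ) := by
  rw [Int.isCoprime_iff_gcd_eq_one]
  change Nat.gcd K.natAbs (r : ℤ).natAbs = 1
  rw [Int.natAbs_natCast]
  have hlt : K.natAbs < r := by
    have : (K.natAbs : ℤ) < r := by rwa [Int.natAbs_of_nonneg hK0.le]
    exact_mod_cast this
  have hndvd : ¬ r ∣ K.natAbs := fun h =>
    absurd (Nat.le_of_dvd (Int.natAbs_pos.mpr hK0.ne') h) (not_le.mpr hlt)
  exact Nat.Coprime.symm ((Nat.Prime.coprime_iff_not_dvd hr).mpr hndvd)

/-- The size bookkeeping in Lemma 7.3: with `x₁ = σy`, `x₂ = m − x₁`, `m x₃ = x₁² − m x₁ − k₄`,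
`r·w = 4x₁x₂x₃ − x₁ − x₂ − x₃` and `y` large, all of `σx₁, −σx₂, x₃, −w` are `≥ B₁`. [folklore] -/
theorem lift_sizes {σ y m r B₁ k₄ x₃ w : ℤ} (hσ : σ = 1 ∨ σ = -1) (hm0 : 0 < m) (hr0 : 0 < r)
    (hB₁ : 1 ≤ B₁) (hk₄ : 0 ≤ k₄) (hy : m * r * B₁ + k₄ + m + B₁ + 1 ≤ y)
    (hmx₃ : m * x₃ = (σ * y) ^ 2 - m * (σ * y) - k₄)
    (hw : 4 * (σ * y) * (m - σ * y) * x₃ - σ * y - (m - σ * y) - x₃ = r * w) :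
    B₁ ≤ σ * (σ * y) ∧ B₁ ≤ -(σ * (m - σ * y)) ∧ B₁ ≤ x₃ ∧ B₁ ≤ -w := by
  have hmrB : 0 ≤ m * r * B₁ := by positivity
  have hmB : m * B₁ ≤ m * r * B₁ := by
    have : 0 ≤ m * B₁ * (r - 1) := mul_nonneg (by positivity) (by linarith)
    linarith
  have hy0 : 0 ≤ y := by linarith
  have hσmy : σ * (m * y) ≤ m * y := by
    rcases hσ with rfl | rfl
    · linarith
    · have : 0 ≤ m * y := by positivity
      linarith
  have hσ2 : σ * σ = 1 := by rcases hσ with rfl | rfl <;> norm_num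
  have hν : y - k₄ ≤ m * x₃ := by
    have h1 : m * x₃ = y ^ 2 - σ * (m * y) - k₄ := by
      rw [hmx₃]; linear_combination (y ^ 2) * hσ2
    have h2 : 0 ≤ y * (y - m - 1) := mul_nonneg hy0 (by linarith)
    nlinarith [h1, h2, hσmy]
  have hx₃B : B₁ ≤ x₃ := by
    have : m * B₁ ≤ m * x₃ := by linarith
    exact le_of_mul_le_mul_left this hm0
  have hx₃rB : r * B₁ ≤ x₃ := by
    have h1 : m * (r * B₁) = m * r * B₁ := by ring
    have : m * (r * B₁) ≤ m * x₃ := by linarith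
    exact le_of_mul_le_mul_left this hm0
  have hx₃0 : 0 ≤ x₃ := by
    have : 0 ≤ r * B₁ := by positivity
    linarith
  have hprod : 0 ≤ -((σ * y) * (m - σ * y)) := by
    have h1 : -((σ * y) * (m - σ * y)) = y ^ 2 - σ * (m * y) := by
      linear_combination (y ^ 2) * hσ2
    have h2 : 0 ≤ y * (y - m) := mul_nonneg hy0 (by linarith)
    nlinarith [h1, h2, hσmy]
  have hW : B₁ ≤ -w := by
    have h1 : r * (-w) = 4 * (-((σ * y) * (m - σ * y))) * x₃ + m + x₃ := by
      linear_combination hw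
    have h2 : 0 ≤ 4 * (-((σ * y) * (m - σ * y))) * x₃ :=
      mul_nonneg (mul_nonneg (by norm_num) hprod) hx₃0
    have h3 : r * B₁ ≤ r * (-w) := by linarith
    exact le_of_mul_le_mul_left h3 hr0
  refine ⟨?_, ?_, hx₃B, hW⟩
  · have : σ * (σ * y) = y := by rw [← mul_assoc, hσ2, one_mul]
    rw [this]; linarith
  · have h1 : -(σ * (m - σ * y)) = y - σ * m := by linear_combination y * hσ2
    have h2 : σ * m ≤ m := by rcases hσ with rfl | rfl <;> linarith
    linarith

/-- **Teräväinen 2024, Lemma 7.3** (finding solutions to a divisibility relation), in the case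
`a₃ = 0` and with the sign of `x₁` prescribed: given residues `a₁, a₂ (mod q)` with
`gcd(4a₁a₂ − 1, q) = 1` and `a₁ + a₂ ≠ 0`, there are integers `x₁ ≡ a₁`, `x₂ ≡ a₂`, `x₃ ≡ 0 (mod q)`,
with `σx₁, −σx₂, x₃` and the quotient `W` all `≥ B`, such that
`S := 4(x₁x₂ + x₂x₃ + x₃x₁) − 1` divides `4x₁x₂x₃ − x₁ − x₂ − x₃ = S·W` (indeed `S = −r` for an
auxiliary prime `r ≡ 1 (mod 4)` supplied by Dirichlet's theorem). The printed construction uses two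
Dirichlet primes `p, r`; here `p` is replaced by an integer `p' ≡ (a₁+a₂)/d (mod q)` and `r` is
taken `≡ 1 (mod 4p')`, `x₁ ≡ 0 (mod p')`, which sidesteps the solvability of
`x₁² ≡ (r−1)/4 (mod dp)` needed in the printed proof. [cite: Teravainen2024, Lemma 7.3] -/
theorem exists_lift_dvd (q : ℕ) (hq : q ≠ 0) (a₁ a₂ : ℤ) (hs : a₁ + a₂ ≠ 0)
    (hcop : IsCoprime (1 - 4 * a₁ * a₂) q) (B σ : ℤ) (hσ : σ = 1 ∨ σ = -1) :
    ∃ x₁ x₂ x₃ W : ℤ, x₁ ≡ a₁ [ZMOD q] ∧ x₂ ≡ a₂ [ZMOD q] ∧ (q : ℤ) ∣ x₃ ∧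
      B ≤ σ * x₁ ∧ B ≤ -(σ * x₂) ∧ B ≤ x₃ ∧ B ≤ W ∧
      4 * (x₁ * x₂ + x₂ * x₃ + x₃ * x₁) - 1 ≠ 0 ∧
      (4 * (x₁ * x₂ + x₂ * x₃ + x₃ * x₁) - 1) * W = 4 * x₁ * x₂ * x₃ - x₁ - x₂ - x₃ := by
  have hq0 : (0 : ℤ) < q := by exact_mod_cast Nat.pos_of_ne_zero hq
  -- Chinese remainder theorem for two coprime integer moduli (from a Bézout relation)
  have crt : ∀ {m n : ℤ}, IsCoprime m n → ∀ a b : ℤ, ∃ x : ℤ, x ≡ a [ZMOD m] ∧ x ≡ b [ZMOD n] := by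
    intro m n h a b
    obtain ⟨u, v, huv⟩ := h
    refine ⟨b * (u * m) + a * (v * n), ?_, ?_⟩
    · exact Int.modEq_iff_dvd.mpr ⟨(a - b) * u, by linear_combination (-a) * huv⟩
    · exact Int.modEq_iff_dvd.mpr ⟨(b - a) * v, by linear_combination (-b) * huv⟩
  obtain ⟨B₁, hB₁⟩ : ∃ B₁ : ℤ, B₁ = max B 1 := ⟨_, rfl⟩
  have hB₁1 : 1 ≤ B₁ := hB₁ ▸ le_max_right _ _
  have hBB₁ : B ≤ B₁ := hB₁ ▸ le_max_left _ _
  have hσ2 : σ * σ = 1 := by rcases hσ with rfl | rfl <;> norm_num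
  -- Step 1: the `q`-smooth part `d` of `s = a₁ + a₂`
  obtain ⟨d, e, n, hd, hse, hdq, hcope⟩ := exists_smooth_part q (a₁ + a₂) hs
  -- Step 2: `p' ≡ e (mod q)`, positive, coprime to `q` and `d`; `m = d p' ≡ a₁ + a₂ (mod qd)`
  obtain ⟨p', hp'⟩ : ∃ p' : ℤ, p' = e + q * (e.natAbs + 1) := ⟨_, rfl⟩
  have hp'pos : 0 < p' := by
    have h1 : -e ≤ (e.natAbs : ℤ) := by rw [Int.natCast_natAbs]; exact neg_le_abs e
    have h2 : (1 : ℤ) * (e.natAbs + 1) ≤ q * (e.natAbs + 1) :=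
      mul_le_mul_of_nonneg_right (by omega) (by positivity)
    linarith
  have hcopp'q : IsCoprime p' q := hp' ▸ hcope.add_mul_left_left _
  have hcopp'd : IsCoprime p' d := (hcopp'q.pow_right (n := n)).of_isCoprime_of_dvd_right hdq
  obtain ⟨m, hm⟩ : ∃ m : ℤ, m = d * p' := ⟨_, rfl⟩
  have hm0 : 0 < m := hm ▸ mul_pos hd hp'pos
  have hms : m ≡ a₁ + a₂ [ZMOD q * d] :=
    Int.modEq_iff_dvd.mpr ⟨-(e.natAbs + 1 : ℤ), by rw [hse, hm, hp']; ring⟩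
  have hmsq : m ≡ a₁ + a₂ [ZMOD q] := hms.of_mul_right d
  -- Step 3: `ρ₀ ≡ −a₁a₂ (mod qd)`, `ρ₀ ≡ 0 (mod p')`
  have hcop_qd_p' : IsCoprime ((q : ℤ) * d) p' := hcopp'q.symm.mul_left hcopp'd.symm
  obtain ⟨ρ₀, hρ₁, hρ₂⟩ := crt hcop_qd_p' (-(a₁ * a₂)) 0
  -- Step 4: a prime `r ≡ 1 + 4ρ₀ (mod 4 q d p')`, `r > 4 q d p'`
  obtain ⟨M, hM⟩ : ∃ M : ℤ, M = 4 * (q * d) * p' := ⟨_, rfl⟩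
  have hM0 : 0 < M := by rw [hM]; positivity
  have hcopM : IsCoprime (1 + 4 * ρ₀) M := by
    rw [hM]
    refine IsCoprime.mul_right (IsCoprime.mul_right ?_ (IsCoprime.mul_right ?_ ?_)) ?_
    · exact isCoprime_one_left.add_mul_left_left ρ₀
    · obtain ⟨j, hj⟩ := (Int.modEq_iff_dvd.mp (hρ₁.of_mul_right d))
      have : 1 + 4 * ρ₀ = (1 - 4 * a₁ * a₂) + q * (-4 * j) := by linear_combination (-4) * hj
      rw [this]; exact hcop.add_mul_left_left _
    · obtain ⟨j, hj⟩ := (Int.modEq_iff_dvd.mp (hρ₁.of_mul_left q))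
      have hcopd : IsCoprime (1 - 4 * a₁ * a₂) d :=
        (hcop.pow_right (n := n)).of_isCoprime_of_dvd_right hdq
      have : 1 + 4 * ρ₀ = (1 - 4 * a₁ * a₂) + d * (-4 * j) := by linear_combination (-4) * hj
      rw [this]; exact hcopd.add_mul_left_left _
    · obtain ⟨j, hj⟩ := (Int.modEq_iff_dvd.mp hρ₂)
      have : 1 + 4 * ρ₀ = 1 + p' * (-4 * j) := by linear_combination (-4) * hj
      rw [this]; exact isCoprime_one_left.add_mul_left_left _
  have hMnat : ((M.toNat : ℕ) : ℤ) = M := Int.toNat_of_nonneg hM0.le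
  obtain ⟨r, hrgt, hr, hrmod⟩ := Nat.forall_exists_prime_gt_and_zmodEq M.toNat
    (q := M.toNat) (a := 1 + 4 * ρ₀) (by omega) (by rwa [hMnat])
  rw [hMnat] at hrmod
  have hrM : M < r := by
    have : (M.toNat : ℤ) < r := by exact_mod_cast hrgt
    rwa [hMnat] at this
  have hr0 : (0 : ℤ) < r := hM0.trans hrM
  -- `r ≡ 1 (mod 4)`; write `r = 4 k₄ + 1`
  have hr4 : (r : ℤ) % 4 = 1 := by
    have h := (hrmod.of_dvd ⟨(q * d) * p', by rw [hM]; ring⟩ : (r : ℤ) ≡ 1 + 4 * ρ₀ [ZMOD 4])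
    rw [h.eq]; omega
  obtain ⟨k₄, hk₄⟩ : ∃ k₄ : ℤ, (r : ℤ) = 4 * k₄ + 1 := ⟨(r : ℤ) / 4, by omega⟩
  have hk₄0 : 0 ≤ k₄ := by omega
  have hk_qd : k₄ ≡ ρ₀ [ZMOD q * d] := by
    have h := (hrmod.of_dvd ⟨p', by rw [hM]⟩ : (r : ℤ) ≡ 1 + 4 * ρ₀ [ZMOD 4 * (q * d)])
    obtain ⟨j, hj⟩ := Int.modEq_iff_dvd.mp h
    refine Int.modEq_iff_dvd.mpr ⟨j, ?_⟩
    apply mul_left_cancel₀ (by norm_num : (4 : ℤ) ≠ 0)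
    linear_combination hj + hk₄
  have hk_p' : k₄ ≡ 0 [ZMOD p'] := by
    have h := (hrmod.of_dvd ⟨q * d, by rw [hM]; ring⟩ : (r : ℤ) ≡ 1 + 4 * ρ₀ [ZMOD 4 * p'])
    obtain ⟨j, hj⟩ := Int.modEq_iff_dvd.mp h
    refine (Int.modEq_iff_dvd.mpr ⟨j, ?_⟩ : k₄ ≡ ρ₀ [ZMOD p']).trans hρ₂
    apply mul_left_cancel₀ (by norm_num : (4 : ℤ) ≠ 0)
    linear_combination hj + hk₄
  -- Step 5: `c₁` with `r ∣ 4 c₁² + 1` (`r ≡ 1 (mod 4)` is prime)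
  haveI := Fact.mk hr
  have hr4' : r % 4 ≠ 3 := by omega
  obtain ⟨c, hc⟩ := ZMod.exists_sq_eq_neg_one_iff.mpr hr4'
  have hc₀ : (r : ℤ) ∣ (c.val : ℤ) ^ 2 + 1 := by
    apply (ZMod.intCast_zmod_eq_zero_iff_dvd _ r).mp
    push_cast
    rw [ZMod.natCast_zmod_val, pow_two, ← hc]; ring
  obtain ⟨j₂, hj₂⟩ : ∃ j₂ : ℤ, (r : ℤ) + 1 = 2 * j₂ := ⟨((r : ℤ) + 1) / 2, by omega⟩
  obtain ⟨c₁, hc₁⟩ : ∃ c₁ : ℤ, c₁ = (c.val : ℤ) * j₂ := ⟨_, rfl⟩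
  have hc₁r : (r : ℤ) ∣ 4 * c₁ ^ 2 + 1 := by
    obtain ⟨t, ht⟩ := hc₀
    exact ⟨(c.val : ℤ) ^ 2 * (r + 2) + t, by
      rw [hc₁]; linear_combination (-((c.val : ℤ) ^ 2 * (2 * j₂ + r + 1))) * hj₂ + ht⟩
  -- Step 6: `x_c ≡ a₁ (mod qd)`, `≡ 0 (mod p')`, `≡ c₁ (mod r)`
  obtain ⟨x', hx'1, hx'2⟩ := crt hcop_qd_p' a₁ 0
  have hLpos : (0 : ℤ) < q * d * p' := by positivity
  have hLr : (q : ℤ) * d * p' < r := by linarith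
  have hcop_L_r : IsCoprime ((q : ℤ) * d * p') r := isCoprime_of_prime_of_lt hr hLpos hLr
  obtain ⟨xc, hxc1, hxc2⟩ := crt hcop_L_r x' c₁
  -- Step 7: a large representative with the prescribed sign
  obtain ⟨L, hL⟩ : ∃ L : ℤ, L = q * d * p' * r := ⟨_, rfl⟩
  have hL0 : 0 < L := by rw [hL]; positivity
  obtain ⟨y, hy1, hy2⟩ := exists_modEq_ge L hL0 (σ * xc) (m * r * B₁ + k₄ + m + B₁ + 1)
  obtain ⟨x₁, hx₁⟩ : ∃ x₁ : ℤ, x₁ = σ * y := ⟨_, rfl⟩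
  have hx₁L : x₁ ≡ xc [ZMOD L] :=
    calc x₁ = σ * y := hx₁
      _ ≡ σ * (σ * xc) [ZMOD L] := hy1.mul_left σ
      _ = xc := by rw [← mul_assoc, hσ2, one_mul]
  have hx₁qd : x₁ ≡ a₁ [ZMOD q * d] :=
    ((hx₁L.of_dvd ⟨p' * r, by rw [hL]; ring⟩).trans (hxc1.of_mul_right p')).trans hx'1
  have hx₁q : x₁ ≡ a₁ [ZMOD q] := hx₁qd.of_mul_right d
  have hx₁p' : x₁ ≡ 0 [ZMOD p'] :=
    ((hx₁L.of_dvd ⟨q * d * r, by rw [hL]; ring⟩).trans (hxc1.of_dvd ⟨q * d, by ring⟩)).trans hx'2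
  have hx₁r : x₁ ≡ c₁ [ZMOD r] := (hx₁L.of_dvd ⟨q * d * p', by rw [hL]; ring⟩).trans hxc2
  have hrx : (r : ℤ) ∣ 4 * x₁ ^ 2 + 1 :=
    dvd_of_modEq_of_dvd (((hx₁r.pow 2).mul_left 4).add_right 1) hc₁r
  -- Step 8: `x₂ = m − x₁`; `ν = x₁² − m x₁ − k₄` is divisible by `q m = q d p'`; `x₃ = ν / m`
  have hν_qd : (q : ℤ) * d ∣ x₁ ^ 2 - m * x₁ - k₄ := by
    have h := ((hx₁qd.pow 2).sub (hms.mul hx₁qd)).sub (hk_qd.trans hρ₁)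
    have h0 : a₁ ^ 2 - (a₁ + a₂) * a₁ - -(a₁ * a₂) = 0 := by ring
    rw [h0] at h
    exact Int.modEq_zero_iff_dvd.mp h
  have hν_p' : p' ∣ x₁ ^ 2 - m * x₁ - k₄ := by
    have h := ((hx₁p'.pow 2).sub ((Int.ModEq.refl m).mul hx₁p')).sub hk_p'
    have h0 : (0 : ℤ) ^ 2 - m * 0 - 0 = 0 := by ring
    rw [h0] at h
    exact Int.modEq_zero_iff_dvd.mp h
  obtain ⟨c₃, hc₃⟩ := hcop_qd_p'.mul_dvd hν_qd hν_p'
  obtain ⟨x₃, hx₃⟩ : ∃ x₃ : ℤ, x₃ = q * c₃ := ⟨_, rfl⟩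
  have hmx₃ : m * x₃ = x₁ ^ 2 - m * x₁ - k₄ := by rw [hc₃, hx₃, hm]; ring
  -- Step 9: `S = −r`
  have hSr : 4 * (x₁ * (m - x₁) + (m - x₁) * x₃ + x₃ * x₁) - 1 = -(r : ℤ) := by
    linear_combination 4 * hmx₃ + hk₄
  -- Step 10: `r ∣ T'`
  have h4mT : 4 * m * (4 * x₁ * (m - x₁) * x₃ - x₁ - (m - x₁) - x₃) =
      (4 * x₁ ^ 2 + 1) * (8 * m * x₁ - (4 * x₁ ^ 2 + 1) - 4 * m ^ 2)
        - r * (4 * x₁ * m - (4 * x₁ ^ 2 + 1)) := by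
    linear_combination (16 * x₁ * (m - x₁) - 4) * hmx₃ + (4 * x₁ * m - (4 * x₁ ^ 2 + 1)) * hk₄
  have hrT : (r : ℤ) ∣ 4 * x₁ * (m - x₁) * x₃ - x₁ - (m - x₁) - x₃ := by
    have h1 : (r : ℤ) ∣ 4 * m * (4 * x₁ * (m - x₁) * x₃ - x₁ - (m - x₁) - x₃) := by
      rw [h4mT]; exact dvd_sub (dvd_mul_of_dvd_left hrx _) (dvd_mul_right _ _)
    have h41 : (4 : ℤ) * m ≤ M := by
      have : d * p' ≤ q * (d * p') := le_mul_of_one_le_left (by positivity) (by omega)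
      rw [hM, hm]; linarith
    have h2 : IsCoprime (r : ℤ) (4 * m) :=
      (isCoprime_of_prime_of_lt hr (by positivity) (by linarith)).symm
    exact h2.dvd_of_dvd_mul_left h1
  obtain ⟨w, hw⟩ := hrT
  -- Step 11: sizes, and assembly
  have hmx₃' := hmx₃
  have hw' := hw
  rw [hx₁] at hmx₃' hw'
  obtain ⟨hs1, hs2, hs3, hs4⟩ := lift_sizes hσ hm0 hr0 hB₁1 hk₄0 hy2 hmx₃' hw'
  refine ⟨x₁, m - x₁, x₃, -w, hx₁q, ?_, ⟨c₃, hx₃⟩, ?_, ?_, hBB₁.trans hs3, hBB₁.trans hs4, ?_, ?_⟩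
  · have := hmsq.sub hx₁q
    simpa using this
  · rw [hx₁]; exact hBB₁.trans hs1
  · rw [hx₁]; exact hBB₁.trans hs2
  · rw [hSr]; exact neg_ne_zero.mpr hr0.ne'
  · rw [hSr, hw]; ring

/-! ### The endgame congruence (Teräväinen 2024, §7.4, adapted) -/

/-- Parities in `N² + 1 = p y²` with `p ≡ 1 (mod 4)`: `N` is even and `y` is odd. [folklore] -/
theorem even_and_odd_of_neg_pell {N y p : ℤ} (hp : 4 ∣ p - 1) (h : N ^ 2 + 1 = p * y ^ 2) :
    2 ∣ N ∧ ¬ 2 ∣ y := by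
  have hp1 : ((p : ℤ) : ZMod 4) = 1 := by
    have : ((p : ℤ) : ZMod 4) = ((1 : ℤ) : ZMod 4) :=
      ((ZMod.intCast_eq_intCast_iff_dvd_sub 1 p 4).mpr (by simpa using hp)).symm
    simpa using this
  have key : ((N : ZMod 4)) ^ 2 + 1 = (y : ZMod 4) ^ 2 := by
    have := congrArg (Int.cast : ℤ → ZMod 4) h
    push_cast at this
    rwa [hp1, one_mul] at this
  have hall : ∀ a b : ZMod 4, a ^ 2 + 1 = b ^ 2 →
      (a = ((0 : ℤ) : ZMod 4) ∨ a = ((2 : ℤ) : ZMod 4)) ∧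
        (b = ((1 : ℤ) : ZMod 4) ∨ b = ((3 : ℤ) : ZMod 4)) := by
    decide
  obtain ⟨hN, hy⟩ := hall _ _ key
  constructor
  · rcases hN with hN | hN <;>
      have := (ZMod.intCast_eq_intCast_iff' _ _ 4).mp hN <;> omega
  · rcases hy with hy | hy <;>
      have := (ZMod.intCast_eq_intCast_iff' _ _ 4).mp hy <;> omega

/-- If `N = 2·Nh`, `u₁ + u₂ = 1` and `Nh² + uᵢ − uᵢ² = K` is divisible by `Q` for `i = 1, 2`, then
`N a² + 2a ≡ N (mod Q)` has a solution `a` with `a² − 1` coprime to `Q`: modulo a prime power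
`ℓᵏ ∥ Q` take `a ≡ Nh·uᵢ⁻¹` with `ℓ ∤ uᵢ`, and glue by the Chinese remainder theorem. (This replaces
the appeal to the character classification, Prop. 7.4 of the source, in our rendering of §7.4.)
[folklore] -/
theorem exists_root_quadratic_congr {N Nh K u₁ u₂ : ℤ} (hN : N = 2 * Nh) (hu : u₁ + u₂ = 1)
    (hK₁ : Nh ^ 2 + u₁ - u₁ ^ 2 = K) (hK₂ : Nh ^ 2 + u₂ - u₂ ^ 2 = K) {Q : ℕ} (hQ : Q ≠ 0)
    (hQK : (Q : ℤ) ∣ K) :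
    ∃ a : ℤ, (Q : ℤ) ∣ N * a ^ 2 + 2 * a - N ∧ IsCoprime (a ^ 2 - 1) (Q : ℤ) := by
  -- Chinese remainder theorem for two coprime integer moduli (from a Bézout relation)
  have crt : ∀ {m n : ℤ}, IsCoprime m n → ∀ a b : ℤ, ∃ x : ℤ, x ≡ a [ZMOD m] ∧ x ≡ b [ZMOD n] := by
    intro m n h a b
    obtain ⟨u, v, huv⟩ := h
    refine ⟨b * (u * m) + a * (v * n), ?_, ?_⟩
    · exact Int.modEq_iff_dvd.mpr ⟨(a - b) * u, by linear_combination (-a) * huv⟩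
    · exact Int.modEq_iff_dvd.mpr ⟨(b - a) * v, by linear_combination (-b) * huv⟩
  suffices H : ∀ m : ℕ, (m : ℤ) ∣ Q →
      ∃ a : ℤ, (m : ℤ) ∣ N * a ^ 2 + 2 * a - N ∧ IsCoprime (a ^ 2 - 1) (m : ℤ) from H Q dvd_rfl
  intro m
  induction m using Nat.recOnPrimeCoprime with
  | zero =>
    intro h0
    rw [Nat.cast_zero, zero_dvd_iff, Nat.cast_eq_zero] at h0
    exact absurd h0 hQ
  | prime_pow ℓ k hℓ =>
    intro hdiv
    rcases Nat.eq_zero_or_pos k with rfl | hk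
    · exact ⟨0, by simp, by rw [pow_zero, Nat.cast_one]; exact isCoprime_one_right⟩
    · have hℓZ : Prime (ℓ : ℤ) := Nat.prime_iff_prime_int.mp hℓ
      push_cast at hdiv ⊢
      have hLK : (ℓ : ℤ) ^ k ∣ K := dvd_trans hdiv hQK
      -- choose `u ∈ {u₁, u₂}` not divisible by `ℓ`
      obtain ⟨u, hKu, hcu⟩ : ∃ u : ℤ, Nh ^ 2 + u - u ^ 2 = K ∧ IsCoprime u (ℓ : ℤ) := by
        by_cases h1 : (ℓ : ℤ) ∣ u₁
        · refine ⟨u₂, hK₂, ((Prime.coprime_iff_not_dvd hℓZ).mpr ?_).symm⟩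
          intro h2
          have : (ℓ : ℤ) ∣ 1 := hu ▸ dvd_add h1 h2
          exact hℓZ.not_unit (isUnit_of_dvd_one this)
        · exact ⟨u₁, hK₁, ((Prime.coprime_iff_not_dvd hℓZ).mpr h1).symm⟩
      have hcuL : IsCoprime u ((ℓ : ℤ) ^ k) := hcu.pow_right
      obtain ⟨ū, v, hūv⟩ := hcuL
      have hLu : IsCoprime ((ℓ : ℤ) ^ k) u := ⟨v, ū, by linear_combination hūv⟩
      have h1 : u * (Nh * ū) ≡ Nh [ZMOD (ℓ : ℤ) ^ k] :=
        Int.modEq_iff_dvd.mpr ⟨Nh * v, by linear_combination (-Nh) * hūv⟩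
      refine ⟨Nh * ū, ?_, ?_⟩
      · have h2 := (((h1.pow 2).mul_left N).add (h1.mul_left (2 * u))).sub_right (N * u ^ 2)
        have h3 : (ℓ : ℤ) ^ k ∣ N * Nh ^ 2 + 2 * u * Nh - N * u ^ 2 := by
          have e : N * Nh ^ 2 + 2 * u * Nh - N * u ^ 2 = N * K := by rw [← hKu, hN]; ring
          rw [e]; exact dvd_mul_of_dvd_right hLK N
        have h4 : (ℓ : ℤ) ^ k ∣ u ^ 2 * (N * (Nh * ū) ^ 2 + 2 * (Nh * ū) - N) := by
          have := dvd_of_modEq_of_dvd h2 h3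
          have e : N * (u * (Nh * ū)) ^ 2 + 2 * u * (u * (Nh * ū)) - N * u ^ 2 =
              u ^ 2 * (N * (Nh * ū) ^ 2 + 2 * (Nh * ū) - N) := by ring
          rwa [e] at this
        exact hLu.pow_right.dvd_of_dvd_mul_left h4
      · have h5 := (h1.pow 2).sub_right (u ^ 2)
        have h6 : (ℓ : ℤ) ^ k ∣ -u - (Nh ^ 2 - u ^ 2) := by
          have e : -u - (Nh ^ 2 - u ^ 2) = -K := by rw [← hKu]; ring
          rw [e]; exact (dvd_neg).mpr hLK
        have h7 : (u * (Nh * ū)) ^ 2 - u ^ 2 ≡ -u [ZMOD (ℓ : ℤ) ^ k] :=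
          h5.trans (Int.modEq_iff_dvd.mpr h6)
        obtain ⟨j, hj⟩ := Int.modEq_iff_dvd.mp h7
        have e : u ^ 2 * ((Nh * ū) ^ 2 - 1) = -u + (ℓ : ℤ) ^ k * (-j) := by
          linear_combination (-1 : ℤ) * hj
        have hcop1 : IsCoprime (-u + (ℓ : ℤ) ^ k * (-j)) ((ℓ : ℤ) ^ k) :=
          hLu.symm.neg_left.add_mul_left_left (-j)
        rw [← e] at hcop1
        exact hcop1.of_mul_left_right
  | coprime m₁ m₂ hm₁ hm₂ hcop ih₁ ih₂ =>
    intro hdiv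
    push_cast at hdiv ⊢
    obtain ⟨b₁, hb₁, hc₁⟩ := ih₁ (dvd_trans (Dvd.intro _ rfl) hdiv)
    obtain ⟨b₂, hb₂, hc₂⟩ := ih₂ (dvd_trans (Dvd.intro_left _ rfl) hdiv)
    have hcopZ : IsCoprime (m₁ : ℤ) (m₂ : ℤ) := Nat.isCoprime_iff_coprime.mpr hcop
    obtain ⟨a, ha₁, ha₂⟩ := crt hcopZ b₁ b₂
    refine ⟨a, hcopZ.mul_dvd ?_ ?_, IsCoprime.mul_right ?_ ?_⟩
    · exact dvd_of_modEq_of_dvd ((((ha₁.pow 2).mul_left N).add (ha₁.mul_left 2)).sub_right N) hb₁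
    · exact dvd_of_modEq_of_dvd ((((ha₂.pow 2).mul_left N).add (ha₂.mul_left 2)).sub_right N) hb₂
    · obtain ⟨j, hj⟩ := Int.modEq_iff_dvd.mp ((ha₁.pow 2).sub_right 1)
      have e : a ^ 2 - 1 = (b₁ ^ 2 - 1) + (m₁ : ℤ) * (-j) := by linear_combination (-1 : ℤ) * hj
      rw [e]; exact hc₁.add_mul_left_left _
    · obtain ⟨j, hj⟩ := Int.modEq_iff_dvd.mp ((ha₂.pow 2).sub_right 1)
      have e : a ^ 2 - 1 = (b₂ ^ 2 - 1) + (m₂ : ℤ) * (-j) := by linear_combination (-1 : ℤ) * hj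
      rw [e]; exact hc₂.add_mul_left_left _

/-! ### `λ(n²+1)` is not eventually periodic (the heart of Theorem 2.3) -/

/-- **`λ(n² + 1)` is not eventually periodic** (Teräväinen 2024, §7, Steps 2–4 of the proof of
Theorem 2.3, in the streamlined form described in the module docstring): there are no `q ≥ 1`
and `C` with `λ((n+q)²+1) = λ(n²+1)` for all `n ≥ C`.
[cite: Teravainen2024, §7 (Steps 2–4 of the proof of Theorem 2.3)] -/
theorem liouvilleInt_sq_add_one_not_eventually_periodic (q : ℕ) (hq : q ≠ 0) (C : ℤ)
    (hper : ∀ n : ℤ, C ≤ n → liouvilleInt ((n + q) ^ 2 + 1) = liouvilleInt (n ^ 2 + 1)) :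
    False := by
  have hq0 : (0 : ℤ) < q := by exact_mod_cast Nat.pos_of_ne_zero hq
  -- F1: `λ(n²+1)` depends only on `n mod q` for `n ≥ C`
  have hstep : ∀ n : ℤ, C ≤ n → ∀ k : ℕ,
      liouvilleInt ((n + q * k) ^ 2 + 1) = liouvilleInt (n ^ 2 + 1) := by
    intro n hn k
    induction k with
    | zero => simp
    | succ k ih =>
      have h0 : (0 : ℤ) ≤ q * k := by positivity
      have h1 := hper (n + q * k) (by linarith)
      rw [← ih, ← h1]; congr 1; push_cast; ring
  have hmod : ∀ n m : ℤ, C ≤ n → C ≤ m → n ≡ m [ZMOD q] →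
      liouvilleInt (n ^ 2 + 1) = liouvilleInt (m ^ 2 + 1) := by
    intro n m hn hm hnm
    wlog hle : n ≤ m generalizing n m
    · exact (this m n hm hn hnm.symm (le_of_not_ge hle)).symm
    obtain ⟨k, hk⟩ := Int.modEq_iff_dvd.mp hnm
    have hk0 : 0 ≤ k := by
      by_contra hneg
      have : (q : ℤ) * k < 0 := mul_neg_of_pos_of_neg hq0 (not_le.mp hneg)
      linarith
    have e : m = n + q * (k.toNat : ℕ) := by
      rw [Int.natCast_toNat_eq_self.mpr hk0]; linarith
    rw [e, hstep n hn]
  -- F2: `λ(n²+1) = 1` on the zero class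
  have hzero : ∀ n : ℤ, C ≤ n → (q : ℤ) ∣ n → liouvilleInt (n ^ 2 + 1) = 1 := by
    intro n hn hqn
    have h2 := liouvilleInt_two (n + 1)
    have e1 : n + 1 - 1 = n := by ring
    rw [e1] at h2
    have hge : C ≤ (n + 1) ^ 2 - (n + 1) + 1 := by nlinarith [sq_nonneg n]
    have hcong : (n + 1) ^ 2 - (n + 1) + 1 ≡ n + 1 [ZMOD q] := by
      refine Int.modEq_iff_dvd.mpr ?_
      have e : n + 1 - ((n + 1) ^ 2 - (n + 1) + 1) = n * (-n) := by ring
      rw [e]; exact dvd_mul_of_dvd_left hqn _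
    rw [hmod _ _ hge (by linarith) hcong] at h2
    exact (mul_right_eq_self₀.mp h2).resolve_right (liouvilleInt_sq_add_one_ne_zero _)
  -- F3: evenness across classes `2b` and `−2b` (Lemma 7.3 with `(a₁,a₂,a₃) = (b,0,0)`, `x₁ < 0`)
  have heven : ∀ b n m : ℤ, C ≤ n → C ≤ m → n ≡ 2 * b [ZMOD q] → m ≡ -(2 * b) [ZMOD q] →
      liouvilleInt (n ^ 2 + 1) = liouvilleInt (m ^ 2 + 1) := by
    intro b n m hn hm hnb hmb
    by_cases hb : b = 0
    · subst hb
      simp only [mul_zero, neg_zero] at hnb hmb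
      exact hmod n m hn hm (hnb.trans hmb.symm)
    obtain ⟨x₁, x₂, x₃, W, hx₁, hx₂, hx₃, hB1, hB2, hB3, hB4, hS, hSW⟩ :=
      exists_lift_dvd q hq b 0 (by simpa using hb) (by simpa using isCoprime_one_left (x := (q : ℤ)))
        (max C 1) (-1) (Or.inr rfl)
    have hS2 : 2 * x₁ * (2 * x₂) + 2 * x₂ * (2 * x₃) + 2 * x₃ * (2 * x₁) - 1 ≠ 0 := by
      convert hS using 1; ring
    have hW2 : (2 * x₁ * (2 * x₂) + 2 * x₂ * (2 * x₃) + 2 * x₃ * (2 * x₁) - 1) * (2 * W) =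
        2 * x₁ * (2 * x₂) * (2 * x₃) - 2 * x₁ - 2 * x₂ - 2 * x₃ := by linear_combination 2 * hSW
    have hid := liouvilleInt_three hS2 hW2
    have hC1 : C ≤ max C 1 := le_max_left _ _
    have h11 : (1 : ℤ) ≤ max C 1 := le_max_right _ _
    have hx₃' : x₃ ≡ 0 [ZMOD q] := Int.modEq_zero_iff_dvd.mpr hx₃
    have hx₂v : liouvilleInt ((2 * x₂) ^ 2 + 1) = 1 :=
      hzero _ (by linarith) (dvd_mul_of_dvd_right (Int.modEq_zero_iff_dvd.mp hx₂) 2)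
    have hx₃v : liouvilleInt ((2 * x₃) ^ 2 + 1) = 1 :=
      hzero _ (by linarith) (dvd_mul_of_dvd_right hx₃ 2)
    have hx₁v : liouvilleInt ((2 * x₁) ^ 2 + 1) = liouvilleInt (m ^ 2 + 1) := by
      have e : (2 * x₁) ^ 2 = (-(2 * x₁)) ^ 2 := by ring
      rw [e]
      exact hmod _ _ (by linarith) hm (((hx₁.mul_left 2).neg).trans hmb.symm)
    have hWv : liouvilleInt ((2 * W) ^ 2 + 1) = liouvilleInt (n ^ 2 + 1) := by
      refine hmod _ _ (by linarith) hn ?_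
      have hSm : 4 * (x₁ * x₂ + x₂ * x₃ + x₃ * x₁) - 1 ≡ -1 [ZMOD q] := by
        have := ((((hx₁.mul hx₂).add (hx₂.mul hx₃')).add (hx₃'.mul hx₁)).mul_left 4).sub_right 1
        simpa using this
      have hTm : 4 * x₁ * x₂ * x₃ - x₁ - x₂ - x₃ ≡ -b [ZMOD q] := by
        have := ((((((hx₁.mul_left 4).mul hx₂).mul hx₃').sub hx₁).sub hx₂).sub hx₃')
        simpa using this
      have hWb : W ≡ b [ZMOD q] := by
        have h1 := hSm.mul_right W
        rw [hSW] at h1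
        have h2 := (hTm.symm.trans h1).neg
        simpa using h2.symm
      exact (hWb.mul_left 2).trans hnb.symm
    rw [hx₂v, hx₃v, hx₁v, hWv] at hid
    simpa using hid.symm
  -- F4: a prime `p ≡ 1 (mod 8q)`, `p > |C|² + 2` (Dirichlet)
  obtain ⟨p, hpgt, hp, hpmod⟩ := Nat.forall_exists_prime_gt_and_zmodEq (C.natAbs ^ 2 + 2)
    (q := 8 * q) (a := 1) (by omega) isCoprime_one_left
  have hpmod' : (p : ℤ) ≡ 1 [ZMOD 8 * q] := by exact_mod_cast hpmod
  obtain ⟨t, ht⟩ := Int.modEq_iff_dvd.mp hpmod'.symm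
  have hp4Z : (4 : ℤ) ∣ (p : ℤ) - 1 := ⟨2 * q * t, by rw [ht]; ring⟩
  have hp4 : p % 4 = 1 := by omega
  -- F5: Legendre
  obtain ⟨N, y, hN0, hy0, hpell⟩ := exists_neg_pell_of_prime_mod_four_eq_one hp hp4
  have hNy : N ^ 2 + 1 = p * y ^ 2 := by linarith
  -- F6: `λ(N²+1) = λ(p y²) = −1`
  have hfN : liouvilleInt (N ^ 2 + 1) = -1 := by
    rw [hNy, liouvilleInt_mul, pow_two, liouvilleInt_mul, liouvilleInt_mul_self hy0.ne',
      liouvilleInt_prime hp]; norm_num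
  -- F7: `N ≥ C`
  have hNC : C ≤ N := by
    have h1 : ((C.natAbs ^ 2 + 2 : ℕ) : ℤ) < p := by exact_mod_cast hpgt
    push_cast at h1
    have hy1 : 1 ≤ y ^ 2 := by nlinarith
    have hp0 : (0 : ℤ) ≤ p := by positivity
    have h2 : (p : ℤ) ≤ N ^ 2 + 1 := by rw [hNy]; nlinarith
    have h3 : |C| ^ 2 < N ^ 2 := by linarith
    have h4 : |C| < N := by
      have := abs_lt_of_sq_lt_sq h3 hN0.le
      rwa [abs_abs] at this
    exact (le_abs_self C).trans h4.le
  -- F8: parities; `N = 2 Nh`, `u₁ = (1+y)/2`, `u₂ = (1−y)/2`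
  obtain ⟨⟨Nh, hNh⟩, hyodd⟩ := even_and_odd_of_neg_pell hp4Z hNy
  obtain ⟨u₁, hu₁⟩ : ∃ u₁ : ℤ, 1 + y = 2 * u₁ := ⟨(1 + y) / 2, by omega⟩
  obtain ⟨u₂, hu₂⟩ : ∃ u₂ : ℤ, 1 - y = 2 * u₂ := ⟨(1 - y) / 2, by omega⟩
  have hu : u₁ + u₂ = 1 := by omega
  have hK₁ : Nh ^ 2 + u₁ - u₁ ^ 2 = 2 * q * t * y ^ 2 := by
    apply mul_left_cancel₀ (by norm_num : (4 : ℤ) ≠ 0)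
    linear_combination (-(N + 2 * Nh)) * hNh + (y + 2 * u₁ - 1) * hu₁ + hNy + y ^ 2 * ht
  have hK₂ : Nh ^ 2 + u₂ - u₂ ^ 2 = 2 * q * t * y ^ 2 := by
    apply mul_left_cancel₀ (by norm_num : (4 : ℤ) ≠ 0)
    linear_combination (-(N + 2 * Nh)) * hNh + (-(y - 2 * u₂ + 1)) * hu₂ + hNy + y ^ 2 * ht
  -- F9: the root `a` of `N a² + 2a ≡ N (mod 2q)` with `a² − 1` coprime to `2q`; `a = 2·tt`
  obtain ⟨a, ha, hacop⟩ := exists_root_quadratic_congr hNh hu hK₁ hK₂ (Q := 2 * q) (by omega)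
    (by push_cast; exact ⟨t * y ^ 2, by ring⟩)
  push_cast at ha hacop
  have hacop2 : IsCoprime (a ^ 2 - 1) (2 : ℤ) := hacop.of_isCoprime_of_dvd_right (Dvd.intro _ rfl)
  have ha2 : (2 : ℤ) ∣ a := by
    by_contra hodd
    obtain ⟨k, hk⟩ : ∃ k, a = 2 * k + 1 := ⟨a / 2, by omega⟩
    have h2 : (2 : ℤ) ∣ a ^ 2 - 1 := ⟨2 * k ^ 2 + 2 * k, by rw [hk]; ring⟩
    have hu2 := hacop2.isUnit_of_dvd' h2 dvd_rfl
    rcases Int.isUnit_iff.mp hu2 with h | h <;> norm_num at h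
  obtain ⟨tt, htt⟩ := ha2
  have haq : (q : ℤ) ∣ N * a ^ 2 + 2 * a - N := dvd_trans (Dvd.intro_left _ rfl) ha
  have hacopq : IsCoprime (a ^ 2 - 1) (q : ℤ) :=
    hacop.of_isCoprime_of_dvd_right (Dvd.intro_left _ rfl)
  by_cases ha0 : a = 0
  · rw [ha0] at haq
    have hqN : (q : ℤ) ∣ N := by
      have : N * (0 : ℤ) ^ 2 + 2 * 0 - N = -N := by ring
      rw [this] at haq; exact dvd_neg.mp haq
    have := hzero N hNC hqN
    rw [hfN] at this; norm_num at this
  -- F10: Lemma 7.3 with `(a₁,a₂,a₃) = (tt,tt,0)`, `x₁ > 0`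
  have htt0 : tt + tt ≠ 0 := by omega
  have hcop' : IsCoprime (1 - 4 * tt * tt) q := by
    have e : 1 - 4 * tt * tt = -(a ^ 2 - 1) := by rw [htt]; ring
    rw [e]; exact hacopq.neg_left
  obtain ⟨x₁, x₂, x₃, W, hx₁, hx₂, hx₃, hB1, hB2, hB3, hB4, hS, hSW⟩ :=
    exists_lift_dvd q hq tt tt htt0 hcop' (max C 1) 1 (Or.inl rfl)
  have hS2 : 2 * x₁ * (2 * x₂) + 2 * x₂ * (2 * x₃) + 2 * x₃ * (2 * x₁) - 1 ≠ 0 := by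
    convert hS using 1; ring
  have hW2 : (2 * x₁ * (2 * x₂) + 2 * x₂ * (2 * x₃) + 2 * x₃ * (2 * x₁) - 1) * (2 * W) =
      2 * x₁ * (2 * x₂) * (2 * x₃) - 2 * x₁ - 2 * x₂ - 2 * x₃ := by linear_combination 2 * hSW
  have hid := liouvilleInt_three hS2 hW2
  have hC1 : C ≤ max C 1 := le_max_left _ _
  have h11 : (1 : ℤ) ≤ max C 1 := le_max_right _ _
  have hx₃' : x₃ ≡ 0 [ZMOD q] := Int.modEq_zero_iff_dvd.mpr hx₃
  -- F11: the values
  have hx₃v : liouvilleInt ((2 * x₃) ^ 2 + 1) = 1 :=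
    hzero _ (by linarith) (dvd_mul_of_dvd_right hx₃ 2)
  have hx₂v : liouvilleInt ((2 * x₂) ^ 2 + 1) = liouvilleInt ((2 * x₁) ^ 2 + 1) := by
    have e : (2 * x₂) ^ 2 = (-(2 * x₂)) ^ 2 := by ring
    rw [e]
    exact (heven tt (2 * x₁) (-(2 * x₂)) (by linarith) (by linarith) (hx₁.mul_left 2)
      ((hx₂.mul_left 2).neg)).symm
  have hWv : liouvilleInt ((2 * W) ^ 2 + 1) = 1 := by
    rw [hx₃v, hx₂v, mul_one, liouvilleInt_mul_self (int_sq_add_one_ne_zero _)] at hid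
    exact hid.symm
  -- F12: `2W ≡ N (mod q)`
  have hSm : 4 * (x₁ * x₂ + x₂ * x₃ + x₃ * x₁) - 1 ≡ a ^ 2 - 1 [ZMOD q] := by
    have := ((((hx₁.mul hx₂).add (hx₂.mul hx₃')).add (hx₃'.mul hx₁)).mul_left 4).sub_right 1
    refine this.trans ?_
    rw [htt]; ring_nf; exact Int.ModEq.rfl
  have hTm : 4 * x₁ * x₂ * x₃ - x₁ - x₂ - x₃ ≡ -a [ZMOD q] := by
    have := ((((((hx₁.mul_left 4).mul hx₂).mul hx₃').sub hx₁).sub hx₂).sub hx₃')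
    refine this.trans ?_
    rw [htt]; ring_nf; exact Int.ModEq.rfl
  have h2W : 2 * W ≡ N [ZMOD q] := by
    have h1 := hSm.symm.mul_right W
    rw [hSW] at h1
    -- h1 : (a² − 1) W ≡ T, and T ≡ −a
    have h2 : (a ^ 2 - 1) * (2 * W) ≡ -(2 * a) [ZMOD q] := by
      have := (h1.trans hTm).mul_left 2
      refine (Int.ModEq.trans ?_ this).trans ?_
      · ring_nf; exact Int.ModEq.rfl
      · ring_nf; exact Int.ModEq.rfl
    have h3 : (a ^ 2 - 1) * N ≡ -(2 * a) [ZMOD q] := by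
      refine Int.modEq_iff_dvd.mpr ?_
      have e : -(2 * a) - (a ^ 2 - 1) * N = -(N * a ^ 2 + 2 * a - N) := by ring
      rw [e]; exact dvd_neg.mpr haq
    have h4 : (q : ℤ) ∣ (a ^ 2 - 1) * (N - 2 * W) := by
      obtain h5 := Int.modEq_iff_dvd.mp (h2.trans h3.symm)
      have e : (a ^ 2 - 1) * (N - 2 * W) = (a ^ 2 - 1) * N - (a ^ 2 - 1) * (2 * W) := by ring
      rw [e]; exact h5
    exact Int.modEq_iff_dvd.mpr (hacopq.symm.dvd_of_dvd_mul_left h4)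
  have hfin := hmod (2 * W) N (by linarith) hNC h2W
  rw [hWv, hfN] at hfin
  norm_num at hfin

/-! ### Theorem 2.3 (Step 1 = Lemma 7.1 of the source, then the core) -/

/-- **Teräväinen 2024, Theorem 2.3** (discharge of `teravainen2024_thm_2_3`): for `k ≥ 1` and
distinct integers `h₁, …, h_k`, `λ(∏ᵢ ((n+hᵢ)²+1))` takes each value `±1` for infinitely many `n`.
Proof as in §7 of the source: if one sign occurred only finitely often, the product would be
eventually constant, so `λ(n²+1)` would satisfy a `±1`-valued recurrence of finite order and hence
be eventually periodic (Lemma 7.1, pigeonhole on windows); this contradicts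
`liouvilleInt_sq_add_one_not_eventually_periodic` (Steps 2–4).
[cite: Teravainen2024, Theorem 2.3 and Lemma 7.1] -/
theorem teravainen2024_thm_2_3_holds : teravainen2024_thm_2_3 := by
  intro k hk h hinj v hv N₀
  by_contra hne
  have hne' : ∀ n : ℕ, N₀ ≤ n → liouvilleInt (∏ i, (((n : ℤ) + h i) ^ 2 + 1)) ≠ v :=
    fun n hn heq => hne ⟨n, hn, heq⟩
  -- the product is `−v` for all integers `n ≥ N₀`
  have hG : ∀ n : ℤ, (N₀ : ℤ) ≤ n → ∏ i, liouvilleInt ((n + h i) ^ 2 + 1) = -v := by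
    intro n hn
    have hn0 : 0 ≤ n := le_trans (by positivity) hn
    have h1 := hne' n.toNat (by omega)
    rw [Int.natCast_toNat_eq_self.mpr hn0, liouvilleInt_prod] at h1
    have h2 : ∏ i, liouvilleInt ((n + h i) ^ 2 + 1) = 1 ∨
        ∏ i, liouvilleInt ((n + h i) ^ 2 + 1) = -1 := by
      apply Finset.prod_induction _ (fun x : ℤ => x = 1 ∨ x = -1)
      · rintro a b (rfl | rfl) (rfl | rfl) <;> norm_num
      · exact Or.inl rfl
      · intro i _; exact liouvilleInt_sq_add_one_eq_one_or _
    rcases hv with rfl | rfl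
    · rcases h2 with h2 | h2
      · exact absurd h2 h1
      · exact h2
    · rcases h2 with h2 | h2
      · rw [h2]; norm_num
      · exact absurd h2 h1
  -- the largest and the smallest shift
  have hne0 : (Finset.univ : Finset (Fin k)).Nonempty := ⟨⟨0, hk⟩, Finset.mem_univ _⟩
  obtain ⟨i₀, -, hi₀⟩ := Finset.exists_max_image Finset.univ h hne0
  obtain ⟨i₁, -, hi₁⟩ := Finset.exists_min_image Finset.univ h hne0
  have hlt : ∀ i, i ≠ i₀ → h i < h i₀ := fun i hi =>
    lt_of_le_of_ne (hi₀ i (Finset.mem_univ _)) fun e => hi (hinj e)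
  obtain ⟨K, hK⟩ : ∃ K : ℕ, (K : ℤ) = h i₀ - h i₁ :=
    ⟨(h i₀ - h i₁).toNat, Int.toNat_of_nonneg (by linarith [hi₁ i₀ (Finset.mem_univ _)])⟩
  -- Claim 1: the recurrence — `λ(m²+1)` is determined by the `K` preceding values
  have claim1 : ∀ m₁ m₂ : ℤ, (N₀ : ℤ) + h i₀ ≤ m₁ → (N₀ : ℤ) + h i₀ ≤ m₂ →
      (∀ j : ℤ, 1 ≤ j → j ≤ K →
        liouvilleInt ((m₁ - j) ^ 2 + 1) = liouvilleInt ((m₂ - j) ^ 2 + 1)) →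
      liouvilleInt (m₁ ^ 2 + 1) = liouvilleInt (m₂ ^ 2 + 1) := by
    intro m₁ m₂ hm₁ hm₂ hwin
    have e1 := hG (m₁ - h i₀) (by linarith)
    have e2 := hG (m₂ - h i₀) (by linarith)
    rw [← Finset.mul_prod_erase _ _ (Finset.mem_univ i₀)] at e1 e2
    have hrest : ∏ i ∈ Finset.univ.erase i₀, liouvilleInt ((m₁ - h i₀ + h i) ^ 2 + 1) =
        ∏ i ∈ Finset.univ.erase i₀, liouvilleInt ((m₂ - h i₀ + h i) ^ 2 + 1) := by
      refine Finset.prod_congr rfl fun i hi => ?_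
      have hii : i ≠ i₀ := Finset.ne_of_mem_erase hi
      have h1 : 1 ≤ h i₀ - h i := by linarith [hlt i hii]
      have h2 : h i₀ - h i ≤ K := by rw [hK]; linarith [hi₁ i (Finset.mem_univ _)]
      have h3 := hwin (h i₀ - h i) h1 h2
      have e3 : m₁ - h i₀ + h i = m₁ - (h i₀ - h i) := by ring
      have e4 : m₂ - h i₀ + h i = m₂ - (h i₀ - h i) := by ring
      rw [e3, e4]; exact h3
    simp only [sub_add_cancel] at e1 e2
    rw [hrest] at e1
    have hne0' : ∏ i ∈ Finset.univ.erase i₀, liouvilleInt ((m₂ - h i₀ + h i) ^ 2 + 1) ≠ 0 :=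
      Finset.prod_ne_zero_iff.mpr fun i _ => liouvilleInt_sq_add_one_ne_zero _
    exact mul_right_cancel₀ hne0' (e1.trans e2.symm)
  -- Claim 2: agreement of two windows propagates forever
  have claim2 : ∀ m₁ m₂ : ℤ, (N₀ : ℤ) + h i₀ ≤ m₁ → (N₀ : ℤ) + h i₀ ≤ m₂ →
      (∀ j : ℤ, 1 ≤ j → j ≤ K →
        liouvilleInt ((m₁ - j) ^ 2 + 1) = liouvilleInt ((m₂ - j) ^ 2 + 1)) →
      ∀ e : ℕ, liouvilleInt ((m₁ + e) ^ 2 + 1) = liouvilleInt ((m₂ + e) ^ 2 + 1) := by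
    intro m₁ m₂ hm₁ hm₂ hwin e
    have key : ∀ e : ℕ, ∀ j : ℤ, 1 ≤ j → j ≤ K →
        liouvilleInt ((m₁ + e - j) ^ 2 + 1) = liouvilleInt ((m₂ + e - j) ^ 2 + 1) := by
      intro e
      induction e with
      | zero => intro j hj1 hj2; simpa using hwin j hj1 hj2
      | succ e ih =>
        intro j hj1 hj2
        have he0 : (0 : ℤ) ≤ e := by positivity
        by_cases hj : j = 1
        · subst hj
          have := claim1 (m₁ + e) (m₂ + e) (by linarith) (by linarith) ih
          push_cast
          have e1 : m₁ + ((e : ℤ) + 1) - 1 = m₁ + e := by ring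
          have e2 : m₂ + ((e : ℤ) + 1) - 1 = m₂ + e := by ring
          rw [e1, e2]; exact this
        · have := ih (j - 1) (by omega) (by omega)
          push_cast
          have e1 : m₁ + (e + 1) - j = m₁ + e - (j - 1) := by ring
          have e2 : m₂ + (e + 1) - j = m₂ + e - (j - 1) := by ring
          rw [e1, e2]; exact this
    have he0 : (0 : ℤ) ≤ e := by positivity
    exact claim1 (m₁ + e) (m₂ + e) (by linarith) (by linarith) (key e)
  -- pigeonhole: two equal windows
  obtain ⟨e₁, e₂, hne12, hwin⟩ := Finite.exists_ne_map_eq_of_infinite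
    (fun (e : ℕ) (j : Fin K) =>
      decide (liouvilleInt (((N₀ : ℤ) + h i₀ + e - 1 - (j : ℕ)) ^ 2 + 1) = 1))
  wlog hlt12 : e₁ < e₂ generalizing e₁ e₂
  · exact this e₂ e₁ hne12.symm hwin.symm (lt_of_le_of_ne (not_lt.mp hlt12) hne12.symm)
  have hwindow : ∀ j : ℤ, 1 ≤ j → j ≤ K →
      liouvilleInt ((((N₀ : ℤ) + h i₀ + e₁) - j) ^ 2 + 1) =
        liouvilleInt ((((N₀ : ℤ) + h i₀ + e₂) - j) ^ 2 + 1) := by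
    intro j hj1 hj2
    have hjK : (j - 1).toNat < K := by omega
    have h0 := congrFun hwin ⟨(j - 1).toNat, hjK⟩
    simp only [decide_eq_decide] at h0
    have ej : (((j - 1).toNat : ℕ) : ℤ) = j - 1 := Int.toNat_of_nonneg (by omega)
    rw [ej] at h0
    have e1 : (N₀ : ℤ) + h i₀ + e₁ - 1 - (j - 1) = (N₀ : ℤ) + h i₀ + e₁ - j := by ring
    have e2 : (N₀ : ℤ) + h i₀ + e₂ - 1 - (j - 1) = (N₀ : ℤ) + h i₀ + e₂ - j := by ring
    rw [e1, e2] at h0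
    rcases liouvilleInt_sq_add_one_eq_one_or ((N₀ : ℤ) + h i₀ + e₁ - j) with h1 | h1
    · rw [h1, h0.mp h1]
    · rcases liouvilleInt_sq_add_one_eq_one_or ((N₀ : ℤ) + h i₀ + e₂ - j) with h2 | h2
      · exact absurd (h0.mpr h2) (by rw [h1]; norm_num)
      · rw [h1, h2]
  -- eventual periodicity with period `e₂ − e₁`
  have he₁0 : (0 : ℤ) ≤ e₁ := by positivity
  have hper : ∀ n : ℤ, (N₀ : ℤ) + h i₀ + e₁ ≤ n →
      liouvilleInt ((n + ((e₂ - e₁ : ℕ) : ℤ)) ^ 2 + 1) = liouvilleInt (n ^ 2 + 1) := by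
    intro n hn
    obtain ⟨e, he⟩ : ∃ e : ℕ, n = (N₀ : ℤ) + h i₀ + e₁ + e :=
      ⟨(n - ((N₀ : ℤ) + h i₀ + e₁)).toNat, by rw [Int.toNat_of_nonneg (by linarith)]; ring⟩
    have he₂0 : (0 : ℤ) ≤ e₂ := by positivity
    have h3 := claim2 ((N₀ : ℤ) + h i₀ + e₁) ((N₀ : ℤ) + h i₀ + e₂) (by linarith)
      (by linarith) hwindow e
    rw [he]
    have ecast : ((e₂ - e₁ : ℕ) : ℤ) = (e₂ : ℤ) - e₁ := by
      rw [Nat.cast_sub hlt12.le]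
    rw [ecast]
    have e3 : (N₀ : ℤ) + h i₀ + e₁ + e + ((e₂ : ℤ) - e₁) = (N₀ : ℤ) + h i₀ + e₂ + e := by ring
    rw [e3]; exact h3.symm
  exact liouvilleInt_sq_add_one_not_eventually_periodic (e₂ - e₁) (by omega) _ hper

end Literature.NumberTheory.Sieve
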